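import Literature.Probability.Percolation.TrackExchangeTransport
import Literature.Probability.LatticeModels.ProdBernoulliIndependence
import HarnessLib

/-!
# Clean configurations of the strip have full measure

A configuration of the strip of `TrackExchangeStrip` is *clean* for the weights `q`
(`TrackExchange.Clean`, `TrackExchangeTransport`) when it contains only coordinates of positive
weight; the pathwise statements of the track-exchange files are made for clean configurations.
This small file records the two measure-theoretic facts that turn them into almost-sure
statements under the product measure `P_q`: the set of clean configurations is measurable, and
its complement is `P_q`-null (a coordinate of weight `0` is a.s. absent; countably many
coordinates). Shared by the horizontal (`HorizontalTransportBound`) and the vertical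
(`OptimalWitness`, `VerticalTransportProcess`) transport files of the Grimmett–Manolescu line.

## References

* G. R. Grimmett, I. Manolescu, PTRF 159 (2014) 273–327, arXiv:1204.0505, §6.2–6.3 (the laws
  `P` of the configuration chains).
-/

noncomputable section

namespace Literature.Probability.Percolation

open LatticeModels MeasureTheory

namespace TrackExchange

/-- **Clean configurations have full measure**: a.s. no coordinate of weight `0` is present.
[folklore] -/
theorem prodBernoulli_setOf_not_clean (q : Sym2 SV → unitInterval) :
    prodBernoulli q {ω | ¬ Clean q ω} = 0 := by
  have h : {ω : Set (Sym2 SV) | ¬ Clean q ω} ⊆ ⋃ e : {e : Sym2 SV // q e = 0}, {ω | (e : Sym2 SV) ∈ ω} := by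
    intro ω hω
    simp only [Clean, not_forall, not_lt, exists_prop] at hω
    obtain ⟨e, he, hq⟩ := hω
    have hq0 : q e = 0 := le_antisymm (by exact_mod_cast hq) (unitInterval.nonneg _)
    exact Set.mem_iUnion.2 ⟨⟨e, hq0⟩, he⟩
  refine measure_mono_null h ((measure_iUnion_null_iff).2 fun e => ?_)
  have h1 := prodBernoulli_real_setOf_mem q (e : Sym2 SV)
  rw [e.2] at h1
  have h2 : (prodBernoulli q).real {ω | (e : Sym2 SV) ∈ ω} = 0 := by simpa using h1
  exact (measureReal_eq_zero_iff (measure_ne_top _ _)).1 h2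

/-- **The set of clean configurations is measurable.** [folklore] -/
theorem measurableSet_setOf_clean (q : Sym2 SV → unitInterval) : MeasurableSet {ω | Clean q ω} := by
  have h : {ω : Set (Sym2 SV) | Clean q ω} = ⋂ e : Sym2 SV, {ω | e ∈ ω → 0 < (q e : ℝ)} := by
    ext ω; simp [Clean]
  rw [h]
  refine MeasurableSet.iInter fun e => ?_
  by_cases hq : 0 < (q e : ℝ)
  · have : {ω : Set (Sym2 SV) | e ∈ ω → 0 < (q e : ℝ)} = Set.univ := by ext ω; simp [hq]
    rw [this]; exact MeasurableSet.univ
  · have : {ω : Set (Sym2 SV) | e ∈ ω → 0 < (q e : ℝ)} = {ω | e ∉ ω} := by ext ω; simp [hq]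
    rw [this]; exact measurableSet_notMem e

/-- Clean configurations, almost surely. [folklore] -/
theorem ae_clean (q : Sym2 SV → unitInterval) : ∀ᵐ ω ∂(prodBernoulli q), Clean q ω := by
  rw [ae_iff]
  exact prodBernoulli_setOf_not_clean q

/-- The measure of an event is the measure of its clean part. [folklore] -/
theorem prodBernoulli_inter_setOf_clean (q : Sym2 SV → unitInterval) (A : Set (Set (Sym2 SV))) :
    prodBernoulli q (A ∩ {ω | Clean q ω}) = prodBernoulli q A :=
  measure_inter_conull (prodBernoulli_setOf_not_clean q)

end TrackExchange

end Literature.Probability.Percolation
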